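import Summits.QuantumFields.BalabanUV.Beta.EriceRemainderEnclosureHistoryAutonomyComparisonAgeCompositionYoungPairMomentRefined
import Summits.QuantumFields.BalabanUV.Beta.EriceRemainderEnclosureHistoryAutonomyComparisonAgeCompositionYoungPairMomentRows

/-!
# EriceRemainderEnclosureHistoryAutonomyComparisonAgeCompositionYoungPairMomentRefinedRows — (E94e) route (N), first order: THE ROWS `k₂ = 9, 10`, AND
# THE CENSUS THREE AGES AT EVERY `k₃` FOR EVERY `2 ≤ k₂ ≤ 10`.  Rational certificates for the displayed inequality of (E94d)
# `flow_nonneg_three_ages_young_pair_moment_refined` at `k₂ = 9` (boxes `[1, 2.7]` with `U = 4`, `[2.7, 3]` with `U = 0`) and `k₂ = 10` (`[1, 2.82]`,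
# `[2.82, 2.86]`, `[2.86, 2.9]` with `U = 6`, `[2.9, 3.1623]` with `U = 2`), `so = 0.6142`, `κ = 0.04311`, young ray constants `⌊10⁴∕√t⌋∕10⁴`, middle ray
# constants `⌊10⁴√(k₂∕(k₂+1+q))⌋∕10⁴` (generated and verified in exact arithmetic by `g84/numerics/rows_cert.py`); with (E90c) (`k₃ ≤ 56`) and (E94c)
# (`2 ≤ k₂ ≤ 8`): **for the profile `{1, k₂, k₃}` with `2 ≤ k₂ ≤ 10` and ANY `k₃ > k₂`, along every admissible flow, every horizon `N ≥ K`, every damping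
# of the self-consistent class: `0 ≤ ε ≤ e`.**  What is left of «the census three ages at every ratio»: `11 ≤ k₂ ≤ 16` with `57 ≤ k₃ ≤ 61∕67∕72∕78∕83∕89`
# (the same letters close `k₂ = 11 … 16` from `k₃ ≥ 62, 68, 73, 79, 84, 90` — successor instances) — a bounded set of ≈ 110 cells

Cell `pub-balaban`, β-function sub-cell, BINDER row D4 «RemainderConst leaves for Bałaban's split» (`HOME/BINDER-OWNERS.md`; owner lineage `b2b-balaban-beta-an4`;
this file by co-owner #2 lineage `b2b-balaban-beta-d4-p2`, generation 84), β-FLOW TEAM duty (1), FREEZE (0) honoured (def-free; nothing restated).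

HONEST FRAMING (page 1, verbatim and binding).  *"Discharging BetaPertH makes Bałaban's UV stability UNCONDITIONAL — a real constructive-QFT result; it is
NOT the continuum limit and NOT the Clay problem."*  THIS FILE DISCHARGES NOTHING OF THE KIND.  Elementary real algebra ∕ real analysis about ABSTRACT
functionals on a box ]0,γ]^ℕ with displayed floors, profiles and signs, and the FIRST-ORDER renewal objects of route (N) built from them — hypotheses of a
census, not facts; the form, signs, ages and moments of Bałaban's (1.22) limit functional are NOT PRINTED ([I] p. 298; GAPS G-t4-U2-1∕-2) and NOT asserted.
Row D4 class UNCHANGED (critical-path width 0; instance 0∕1; D4 DISCHARGE NO DATE).  HONEST DEPENDENCY: continuum YM on T⁴ ⇐ BetaPertH ∧ nine spine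
estimates (0/9 proved); BetaPertH ⇐ (D1) ∧ (D4) ∧ CAP+tail; G-an2-4 gates asym, D1 and NE2/3/4.

Uses (E94d) `flow_nonneg_three_ages_young_pair_moment_refined`, (E94c) `flow_nonneg_census_three_ages_middle_le_eight`, (E90c) `flow_nonneg_three_ages`
BY NAME.  NOT CLAIMED: `k₂ ≥ 11`; anything printed — NOT B12 Thm 2, NOT BetaPertH, NOT continuum, NOT Clay.

WHAT IS PROVED ([folklore]; 0 `def`, 0 sorry).  `poly_box_refined`, `le_top_of_sq`, `poly_cond_nine`, `poly_cond_ten`,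
**`flow_nonneg_census_three_ages_middle_nine_ten`**, **`flow_nonneg_census_three_ages_middle_le_ten`** (`2 ≤ k₂ ≤ 10`: EVERY `k₃`).
-/
noncomputable section
open Finset

namespace Summit.QuantumFields.BalabanUV.Beta.EriceRemainderEnclosureHistoryAutonomyComparisonAgeCompositionYoungPairMomentRefinedRows

open Literature.MathematicalPhysics.QuantumFieldTheory.Balaban1983to89
open Literature.MathematicalPhysics.QuantumFieldTheory.Balaban1983to89.T4BetaStationary
open Literature.MathematicalPhysics.QuantumFieldTheory.Balaban1983to89.T4BetaFlowWellPosed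
open Summit.QuantumFields.BalabanUV.Beta.EriceRemainderEnclosureHistoryAutonomyComparisonAgeCompositionYoungPairMomentRefined
  (flow_nonneg_three_ages_young_pair_moment_refined)
open Summit.QuantumFields.BalabanUV.Beta.EriceRemainderEnclosureHistoryAutonomyComparisonAgeCompositionYoungPairMomentRows
  (le_top_of_sq flow_nonneg_census_three_ages_middle_le_eight)
open Summit.QuantumFields.BalabanUV.Beta.EriceRemainderEnclosureHistoryAutonomyComparisonAgeCompositionThreeAgesTotalLoad (flow_nonneg_three_ages)

variable {B : (ℕ → ℝ) → ℝ} {γ b gIR : ℝ} {L : ℕ → ℝ} {K : ℕ} {h g : ℕ → ℝ}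

/-! ## The certificates and the rows `k₂ = 9, 10`; the union `2 ≤ k₂ ≤ 10` -/

/-- **ONE BOX OF `σ`, REFINED LETTER.**  On `lo ≤ σ ≤ hi` (`lo > 0`): the step letter weakens by `σ² ≥ lo²`, the refined window letter
`2S·σx + 2c·x + ζσ³y ≤ σ³` gives `ζy ≤ 1` and `(2S∕hi² + 2c∕hi³)x + ζy ≤ 1`; multipliers `ν₀, ν₁ ≥ 0` with `ν₀ + ν₁ ≤ 1 − so` dominating the two columns
certify the displayed inequality. [folklore] -/
theorem poly_box_refined {j ρ ζ so κ lo hi ν₀ ν₁ σ x y S c : ℝ} (hlo0 : 0 < lo) (hlo : lo ≤ σ) (hhi : σ ≤ hi) (hx : 0 ≤ x) (hy : 0 ≤ y)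
    (hj : 0 < j) (hρ0 : 0 ≤ ρ) (hS : 0 ≤ S) (hc : 0 ≤ c) (hν0 : 0 ≤ ν₀) (hν1 : 0 ≤ ν₁)
    (h1 : (141421 : ℝ) / 100000 * x + 2 * ρ / j * σ ^ 2 * y ≤ 1) (h2 : 2 * S * σ * x + 2 * c * x + ζ * σ ^ 3 * y ≤ σ ^ 3)
    (hcx : (1 - so) + κ ≤ ν₀ * (141421 / 100000) + ν₁ * (2 * S / hi ^ 2 + 2 * c / hi ^ 3))
    (hcy : (1 - so) + κ * ((j + 1) / 2) ≤ ν₀ * (2 * ρ / j * lo ^ 2) + ν₁ * ζ) (hsum : ν₀ + ν₁ ≤ 1 - so) :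
    (1 - so) * (x + y) + κ * (x + (j + 1) / 2 * y) ≤ 1 - so := by
  have hσ0 : 0 < σ := lt_of_lt_of_le hlo0 hlo
  have hhi0 : 0 < hi := lt_of_lt_of_le hσ0 hhi
  have hσ3 : 0 < σ ^ 3 := pow_pos hσ0 3
  have h1' : (141421 : ℝ) / 100000 * x + 2 * ρ / j * lo ^ 2 * y ≤ 1 := by
    have : lo ^ 2 ≤ σ ^ 2 := pow_le_pow_left₀ hlo0.le hlo 2
    have := mul_le_mul_of_nonneg_right (mul_le_mul_of_nonneg_left this (show 0 ≤ 2 * ρ / j by positivity)) hy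
    linarith
  have hζy : ζ * y ≤ 1 := by
    have hAx : 0 ≤ 2 * S * σ * x + 2 * c * x := by positivity
    by_contra hneg
    have : σ ^ 3 * 1 < σ ^ 3 * (ζ * y) := mul_lt_mul_of_pos_left (not_le.mp hneg) hσ3
    nlinarith
  have hs2 : σ ^ 2 ≤ hi ^ 2 := pow_le_pow_left₀ hσ0.le hhi 2
  have hs3 : σ ^ 3 ≤ hi ^ 3 := pow_le_pow_left₀ hσ0.le hhi 3
  have t1 : 2 * S / hi ^ 2 * x * σ ^ 3 ≤ 2 * S * σ * x := by
    have e : 2 * S / hi ^ 2 * x * σ ^ 3 = 2 * S * σ * x * (σ ^ 2 / hi ^ 2) := by field_simp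
    rw [e]
    exact mul_le_of_le_one_right (by positivity) ((div_le_one (by positivity)).mpr hs2)
  have t2 : 2 * c / hi ^ 3 * x * σ ^ 3 ≤ 2 * c * x := by
    have e : 2 * c / hi ^ 3 * x * σ ^ 3 = 2 * c * x * (σ ^ 3 / hi ^ 3) := by field_simp
    rw [e]
    exact mul_le_of_le_one_right (by positivity) ((div_le_one (by positivity)).mpr hs3)
  have h2' : (2 * S / hi ^ 2 + 2 * c / hi ^ 3) * x + ζ * y ≤ 1 := by
    have : ((2 * S / hi ^ 2 + 2 * c / hi ^ 3) * x + ζ * y) * σ ^ 3 ≤ 1 * σ ^ 3 := by nlinarith [t1, t2, h2]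
    exact le_of_mul_le_mul_right this hσ3
  have e : (1 - so) * (x + y) + κ * (x + (j + 1) / 2 * y) = ((1 - so) + κ) * x + ((1 - so) + κ * ((j + 1) / 2)) * y := by ring
  rw [e]
  have hX := mul_le_mul_of_nonneg_right hcx hx
  have hY := mul_le_mul_of_nonneg_right hcy hy
  have hB0 := mul_le_mul_of_nonneg_left h1' hν0
  have hB1 := mul_le_mul_of_nonneg_left h2' hν1
  nlinarith [hX, hY, hB0, hB1, hsum]

/-- The displayed inequality for `k₂ = 9` with the refined letters (`ρ = 0.9486`, young ray constants `⌊10⁴∕√t⌋∕10⁴`, middle ray constants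
`⌊10⁴√(9∕(10+q))⌋∕10⁴`, `so = 0.6142`, `κ = 0.04311`; boxes `[1, 2.7]` with `U = 4` and `[2.7, 3]` with `U = 0`). [folklore] -/
theorem poly_cond_nine : ∀ σ x y : ℝ, 1 ≤ σ → σ ^ 2 ≤ ((9 : ℕ) : ℝ) → 0 ≤ x → 0 ≤ y →
    (141421 : ℝ) / 100000 * x + 2 * (4743 / 5000) / ((9 : ℕ) : ℝ) * σ ^ 2 * y ≤ 1 →
    (∀ U : ℕ, U + 1 ≤ 9 → 2 * (∑ u ∈ range U, (fun u : ℕ => if u = 0 then (7071 : ℝ) / 10000 else if u = 1 then 5773 / 10000 else if u = 2 then 1 / 2 else if u = 3 then 559 / 1250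
      else if u = 4 then 2041 / 5000 else if u = 5 then 3779 / 10000 else if u = 6 then 707 / 2000 else 3333 / 10000) u) * σ * x
      + 2 * (((9 : ℕ) : ℝ) - 1 - U + 4743 / 5000) * x
      + 2 * (∑ q ∈ range 9, (fun q : ℕ => if q = 0 then (4743 : ℝ) / 5000 else if q = 1 then 1809 / 2000 else if q = 2 then 433 / 500 else if q = 3 then 104 / 125
      else if q = 4 then 8017 / 10000 else if q = 5 then 1549 / 2000 else if q = 6 then 3 / 4 else if q = 7 then 1819 / 2500 else 7071 / 10000) q) / ((9 : ℕ) : ℝ) * σ ^ 3 * y ≤ σ ^ 3) →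
    (1 - 6142 / 10000) * (x + y) + 4311 / 100000 * (x + (((9 : ℕ) : ℝ) + 1) / 2 * y) ≤ 1 - 6142 / 10000 := by
  intro σ x y h1σ hσ hx hy h1 hW
  have htop : σ ≤ 3 := le_top_of_sq hσ (by norm_num) (by norm_num)
  push_cast at h1 ⊢
  rcases le_or_gt σ (27 / 10) with hb | hb
  · have h2 := hW 4 (by norm_num)
    norm_num [sum_range_succ] at h2
    exact poly_box_refined (lo := 1) (hi := 27 / 10) (ν₀ := 8 / 625) (ν₁ := 36843 / 100000) (S := 5579 / 2500) (c := 24743 / 5000)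
      (ζ := 1828 / 1125) (ρ := 4743 / 5000) (j := 9) (by norm_num) h1σ hb hx hy (by norm_num) (by norm_num) (by norm_num) (by norm_num)
      (by norm_num) (by norm_num) (by linarith) (by linarith) (by norm_num) (by norm_num) (by norm_num)
  · have h2 := hW 0 (by norm_num)
    norm_num [sum_range_succ] at h2
    exact poly_box_refined (lo := 27 / 10) (hi := 3) (ν₀ := 583 / 2500) (ν₁ := 2991 / 20000) (S := 0) (c := 44743 / 5000)
      (ζ := 1828 / 1125) (ρ := 4743 / 5000) (j := 9) (by norm_num) hb.le htop hx hy (by norm_num) (by norm_num) (by norm_num) (by norm_num)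
      (by norm_num) (by norm_num) (by linarith) (by linarith) (by norm_num) (by norm_num) (by norm_num)

/-- The displayed inequality for `k₂ = 10` with the refined letters (`ρ = 0.9534`; boxes `[1, 2.82]`, `[2.82, 2.86]`, `[2.86, 2.9]` with `U = 6` and
`[2.9, 3.1623]` with `U = 2`). [folklore] -/
theorem poly_cond_ten : ∀ σ x y : ℝ, 1 ≤ σ → σ ^ 2 ≤ ((10 : ℕ) : ℝ) → 0 ≤ x → 0 ≤ y →
    (141421 : ℝ) / 100000 * x + 2 * (4767 / 5000) / ((10 : ℕ) : ℝ) * σ ^ 2 * y ≤ 1 →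
    (∀ U : ℕ, U + 1 ≤ 10 → 2 * (∑ u ∈ range U, (fun u : ℕ => if u = 0 then (7071 : ℝ) / 10000 else if u = 1 then 5773 / 10000 else if u = 2 then 1 / 2 else if u = 3 then 559 / 1250
      else if u = 4 then 2041 / 5000 else if u = 5 then 3779 / 10000 else if u = 6 then 707 / 2000 else if u = 7 then 3333 / 10000 else 1581 / 5000) u) * σ * x
      + 2 * (((10 : ℕ) : ℝ) - 1 - U + 4767 / 5000) * x
      + 2 * (∑ q ∈ range 10, (fun q : ℕ => if q = 0 then (4767 : ℝ) / 5000 else if q = 1 then 1141 / 1250 else if q = 2 then 877 / 1000 else if q = 3 then 8451 / 10000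
      else if q = 4 then 2041 / 2500 else if q = 5 then 1581 / 2000 else if q = 6 then 7669 / 10000 else if q = 7 then 7453 / 10000
      else if q = 8 then 3627 / 5000 else 7071 / 10000) q) / ((10 : ℕ) : ℝ) * σ ^ 3 * y ≤ σ ^ 3) →
    (1 - 6142 / 10000) * (x + y) + 4311 / 100000 * (x + (((10 : ℕ) : ℝ) + 1) / 2 * y) ≤ 1 - 6142 / 10000 := by
  intro σ x y h1σ hσ hx hy h1 hW
  have htop : σ ≤ 31623 / 10000 := le_top_of_sq hσ (by norm_num) (by norm_num)
  push_cast at h1 ⊢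
  have h6 := hW 6 (by norm_num)
  norm_num [sum_range_succ] at h6
  rcases le_or_gt σ (141 / 50) with hb | hb
  · exact poly_box_refined (lo := 1) (hi := 141 / 50) (ν₀ := 141 / 50000) (ν₁ := 3823 / 10000) (S := 30177 / 10000) (c := 19767 / 5000)
      (ζ := 81399 / 50000) (ρ := 4767 / 5000) (j := 10) (by norm_num) h1σ hb hx hy (by norm_num) (by norm_num) (by norm_num) (by norm_num)
      (by norm_num) (by norm_num) (by linarith) (by linarith) (by norm_num) (by norm_num) (by norm_num)
  rcases le_or_gt σ (143 / 50) with hc | hc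
  · exact poly_box_refined (lo := 141 / 50) (hi := 143 / 50) (ν₀ := 4189 / 100000) (ν₁ := 34361 / 100000) (S := 30177 / 10000)
      (c := 19767 / 5000) (ζ := 81399 / 50000) (ρ := 4767 / 5000) (j := 10) (by norm_num) hb.le hc hx hy (by norm_num) (by norm_num)
      (by norm_num) (by norm_num) (by norm_num) (by norm_num) (by linarith) (by linarith) (by norm_num) (by norm_num) (by norm_num)
  rcases le_or_gt σ (29 / 10) with hd | hd
  · exact poly_box_refined (lo := 143 / 50) (hi := 29 / 10) (ν₀ := 7277 / 100000) (ν₁ := 7823 / 25000) (S := 30177 / 10000)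
      (c := 19767 / 5000) (ζ := 81399 / 50000) (ρ := 4767 / 5000) (j := 10) (by norm_num) hc.le hd hx hy (by norm_num) (by norm_num)
      (by norm_num) (by norm_num) (by norm_num) (by norm_num) (by linarith) (by linarith) (by norm_num) (by norm_num) (by norm_num)
  · have h2 := hW 2 (by norm_num)
    norm_num [sum_range_succ] at h2
    exact poly_box_refined (lo := 29 / 10) (hi := 31623 / 10000) (ν₀ := 4151 / 20000) (ν₁ := 17819 / 100000) (S := 3211 / 2500)
      (c := 39767 / 5000) (ζ := 81399 / 50000) (ρ := 4767 / 5000) (j := 10) (by norm_num) hd.le htop hx hy (by norm_num) (by norm_num)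
      (by norm_num) (by norm_num) (by norm_num) (by norm_num) (by linarith) (by linarith) (by norm_num) (by norm_num) (by norm_num)

/-- **THE CENSUS THREE AGES `{1, k₂, k₃}` AT EVERY `k₃` FOR `k₂ = 9, 10`.**  `k₃ ≤ 56` by (E90c) `flow_nonneg_three_ages`; `k₃ ≥ 57` by §2 with
`so = 0.6142`, `κ = 0.04311` and the certificates `poly_cond_nine`, `poly_cond_ten` (horizon `N ≥ K`, every damping of the self-consistent class).
[folklore] -/
theorem flow_nonneg_census_three_ages_middle_nine_ten (hmono : ∀ u v : ℕ → ℝ, SeqBox γ u → SeqBox γ v → (∀ j, u j ≤ v j) → B u ≤ B v)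
    (hL : ∀ k, 0 ≤ L k) (hb : 0 < b) (hlo : ∀ u, SeqBox γ u → b ≤ B u) (hdom : ∀ u, SeqBox γ u → ∑ k ∈ range K, L k * u k ≤ B u)
    (hh : SeqBox γ h) (hf : MemFlow B gIR h) (hg : ∀ t, 0 < g t ∧ g t ≤ 1)
    (hgF : ∀ t, 1 ≤ g t * (1 + ∑ k ∈ range K, L k * h (t + k) ^ 3 / 2))
    {k₂ k₃ : ℕ} (hk2 : 9 ≤ k₂) (hk2' : k₂ ≤ 10) (hk23 : k₂ < k₃) (hk3K : k₃ < K)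
    (hL3 : ∀ j, j < K → j ≠ 1 → j ≠ k₂ → j ≠ k₃ → L j = 0)
    {N : ℕ} (hKN : K ≤ N) {KL : ℕ → ℕ → ℕ → ℝ}
    (hKL : ∀ k n l, KL k n l = if 0 < k ∧ k < K ∧ l < k then L k * h (n + k) ^ 3 / 2 * ∏ t ∈ Ico (n + 1 + l) (n + k + 1), g t else 0)
    {KA : ℕ → ℕ → ℕ → ℝ} {RA : ℕ → (ℕ → ℝ) → ℕ → ℝ}
    (hRA : ∀ i v m, RA i v m = ∑ l ∈ range K, KA i m l * v (m + 1 + l))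
    (hKA : ∀ i m l, KA i m l = KL i m l + KA (i + 1) m l) (hKAtop : ∀ m l, KA K m l = 0)
    {e ε : ℕ → ℝ} (he0 : ∀ m, 0 ≤ e m) (hea : ∀ m, e (m + 1) ≤ e m)
    (hεt : ∀ m, N < m → ε m = 0) (hεrec : ∀ m, ε m = e m - RA 1 ε m) : ∀ m, 0 ≤ ε m ∧ ε m ≤ e m := by
  by_cases h56 : k₃ ≤ 56
  · exact flow_nonneg_three_ages hmono hL hb hlo hdom hh hf hg (by omega) hk23 hk3K h56 hL3 hKN hKL hRA hKA hKAtop he0 hea hεt hεrec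
  have hk3r : (57 : ℝ) ≤ k₃ := by exact_mod_cast (show 57 ≤ k₃ by omega)
  have hso : 3 * (k₃ : ℝ) + 1 ≤ 8 * k₃ * ((6142 : ℝ) / 10000) ^ 2 := by nlinarith [hk3r]
  have hκ : 4 * ((6142 : ℝ) / 10000) ≤ 4311 / 100000 * k₃ := by nlinarith [hk3r]
  interval_cases k₂
  · refine flow_nonneg_three_ages_young_pair_moment_refined hmono hL hb hlo hdom hh hf hg hgF (by norm_num) hk23 hk3K hL3 (so := 6142 / 10000)
      (κ := 4311 / 100000) ?_ ?_ ?_ (by norm_num) (by norm_num) hso hκ poly_cond_nine hKL hRA hKA hKAtop he0 hea hεt hεrec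
    · norm_num
    · intro u hu
      have hu' : u ≤ 7 := by omega
      interval_cases u <;> norm_num
    · intro q hq
      interval_cases q <;> norm_num
  · refine flow_nonneg_three_ages_young_pair_moment_refined hmono hL hb hlo hdom hh hf hg hgF (by norm_num) hk23 hk3K hL3 (so := 6142 / 10000)
      (κ := 4311 / 100000) ?_ ?_ ?_ (by norm_num) (by norm_num) hso hκ poly_cond_ten hKL hRA hKA hKAtop he0 hea hεt hεrec
    · norm_num
    · intro u hu
      have hu' : u ≤ 8 := by omega
      interval_cases u <;> norm_num
    · intro q hq
      interval_cases q <;> norm_num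

/-- **THE CENSUS THREE AGES `{1, k₂, k₃}` AT EVERY `k₃` FOR EVERY `2 ≤ k₂ ≤ 10`** ((E94c) `flow_nonneg_census_three_ages_middle_le_eight` and
`flow_nonneg_census_three_ages_middle_nine_ten`). [folklore] -/
theorem flow_nonneg_census_three_ages_middle_le_ten (hmono : ∀ u v : ℕ → ℝ, SeqBox γ u → SeqBox γ v → (∀ j, u j ≤ v j) → B u ≤ B v)
    (hL : ∀ k, 0 ≤ L k) (hb : 0 < b) (hlo : ∀ u, SeqBox γ u → b ≤ B u) (hdom : ∀ u, SeqBox γ u → ∑ k ∈ range K, L k * u k ≤ B u)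
    (hh : SeqBox γ h) (hf : MemFlow B gIR h) (hg : ∀ t, 0 < g t ∧ g t ≤ 1)
    (hgF : ∀ t, 1 ≤ g t * (1 + ∑ k ∈ range K, L k * h (t + k) ^ 3 / 2))
    {k₂ k₃ : ℕ} (hk2 : 2 ≤ k₂) (hk2' : k₂ ≤ 10) (hk23 : k₂ < k₃) (hk3K : k₃ < K)
    (hL3 : ∀ j, j < K → j ≠ 1 → j ≠ k₂ → j ≠ k₃ → L j = 0)
    {N : ℕ} (hKN : K ≤ N) {KL : ℕ → ℕ → ℕ → ℝ}
    (hKL : ∀ k n l, KL k n l = if 0 < k ∧ k < K ∧ l < k then L k * h (n + k) ^ 3 / 2 * ∏ t ∈ Ico (n + 1 + l) (n + k + 1), g t else 0)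
    {KA : ℕ → ℕ → ℕ → ℝ} {RA : ℕ → (ℕ → ℝ) → ℕ → ℝ}
    (hRA : ∀ i v m, RA i v m = ∑ l ∈ range K, KA i m l * v (m + 1 + l))
    (hKA : ∀ i m l, KA i m l = KL i m l + KA (i + 1) m l) (hKAtop : ∀ m l, KA K m l = 0)
    {e ε : ℕ → ℝ} (he0 : ∀ m, 0 ≤ e m) (hea : ∀ m, e (m + 1) ≤ e m)
    (hεt : ∀ m, N < m → ε m = 0) (hεrec : ∀ m, ε m = e m - RA 1 ε m) : ∀ m, 0 ≤ ε m ∧ ε m ≤ e m := by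
  by_cases h8 : k₂ ≤ 8
  · exact flow_nonneg_census_three_ages_middle_le_eight hmono hL hb hlo hdom hh hf hg hgF hk2 h8 hk23 hk3K hL3 hKN hKL hRA hKA hKAtop
      he0 hea hεt hεrec
  · exact flow_nonneg_census_three_ages_middle_nine_ten hmono hL hb hlo hdom hh hf hg hgF (by omega) hk2' hk23 hk3K hL3 hKN hKL hRA hKA hKAtop
      he0 hea hεt hεrec

end Summit.QuantumFields.BalabanUV.Beta.EriceRemainderEnclosureHistoryAutonomyComparisonAgeCompositionYoungPairMomentRefinedRows

end
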